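import Summits.BirchSwinnertonDyer.BirchSwinnertonDyer.Theorems.SignedLowerHalvesSmallImageLowerHalfBothSignsRttJunctionShaLocCountAtP
import Summits.BirchSwinnertonDyer.BirchSwinnertonDyer.Theorems.SignedLowerHalvesSmallImageLowerHalfBothSignsRttJunctionRamified
import HarnessLib

/-!
# Route `SignedLowerHalves`, crux L `SmallImageLowerHalfBothSigns` (stmt-BirchSwinnertonDyer-23599), line `rtt_w3` v30 — stub S3α′ (`stub_junctionShaPT_ns`),
# brick α2-lev (part 5): THE PLACE ABOVE `p` WITHOUT THE `μ`-FIXING HYPOTHESIS — the levelwise uniform bound from ONE `τ ∈ Γ_{K_v}` over `K_∞` with `θ′(res τ) ≠ 1`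

INPUTS hand `bsd-inputs-honda-p1` g28 under LEAD `cruxlead-stmt-BirchSwinnertonDyer-23599` g14 (cell `bsd-ssimc`); helper `--supports stmt-BirchSwinnertonDyer-23599`. THEOREMS ONLY.
WHAT. Part 4 (`exists_bound_semilocCoh_two_of_apply_ne_one`) asked `τ` to FIX the `p`-power roots of unity of `K̄_v`. This is unnecessary: ANY `τ` acts on the cyclic group `μ_{p^k}(K̄_v)` as
`ζ ↦ c•ζ` with `p ∤ c` (`exists_coprime_forall_mu_eq_nsmul`), then `res τ` acts the same way on `μ_{p^k}(K̄)` (`mu_resGalOfEmb_eq_nsmul`, the chosen embedding) and on `𝒪 ⊗ μ_{p^k} ⊗ θ′` as the scalar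
`c·θ′(res τ)` (`muTwistO_resGalOfEmb_eq_oMuScalar_mul`); a `τ`-equivariant `g : X_k → μ_{p^k}` then kills `c(θ′(res τ) − 1)·X_k`, and `c` is invertible on `p`-groups. Hence
★★★ `finite_and_natCard_semilocCoh_two_le_of_apply_ne_one` / `exists_bound_semilocCoh_two_of_apply_ne_one'`: at a place `v` NON-SPLIT in the tower, ONE `τ ∈ Γ_{K_v}` with `res τ ∈ U_n` for all `n`
(`τ` over `K_∞`) and `θ′(res τ) ≠ 1` bounds ALL the levels `H²(Γ_{K_v}, Maps(Γ_K ⧸ U_n, X_k))` uniformly. The displayed input of S3α′ at `vp` is therefore exactly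
«`θ′` is non-trivial on `D_{vp} ∩ Gal(K̄/K_∞)`» — for the frame's `θ` (`θ′·θ₀₀ = 1`) and `j : E[p^∞] → Cofree θ` equivariant at `vp`, this is «`D_{vp} ∩ Gal(K̄/K_∞)` does not fix `E[p^∞]`», a
consequence of the tree's Imai/Serre engine (`localTowerTorsionFiniteAt_of_noStableDivisibleLine`, `Serre1967.eq_bot_of_stable_localPoints`) once `μ_p ⊄ K_{vp}`; NOT proved here.
HONEST FRAMING: nothing about S3α′, E2, crux L or BSD is proved; all remain OPEN and are proved for NO curve.
References: [NeukirchSchmidtWingberg2008] (7.2.6), (8.6.2); [MilneADT2006] I Cor. 2.3; [PerrinRiou1994Invent] §1.3; [Imai1975] Theorem (p. 12).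
-/

set_option autoImplicit false
set_option linter.dupNamespace false -- D-0017: single-problem summit, the namespace repeats the problem name by design
noncomputable section

open scoped Classical TensorProduct
open NumberField IsDedekindDomain Field CategoryTheory Function

namespace Summit.BirchSwinnertonDyer.BirchSwinnertonDyer.Theorems.SmallImageRttJunctionSha

open Literature.NumberTheory.EllipticCurves Literature.NumberTheory.GaloisRepresentations Literature.NumberTheory.GaloisRepresentations.DiscreteGaloisModule
  Literature.NumberTheory.ComplexMultiplication.EllipticUnits.JohnsonLeungKings2011
  Summit.BirchSwinnertonDyer.BirchSwinnertonDyer.Theorems.SmallImageRttD2J1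
  Summit.BirchSwinnertonDyer.BirchSwinnertonDyer.Theorems.SmallImageRttD2Seq

/-! ## §1 Every Galois element acts on `μ_{p^k}` as a prime-to-`p` power -/

section Cyc

variable {K : Type} [Field K] [NumberField K] {p : ℕ} [Fact p.Prime] (S : Set (PadicAlgCl p))
  (θ' : absoluteGaloisGroup K →ₜ* (padicCoeffIntegers S)ˣ) (w : HeightOneSpectrum (𝓞 K))

omit [NumberField K] in
/-- **Every `τ ∈ Γ_F` acts on the cyclic group `μ_{p^k}(F̄)` as `ζ ↦ c • ζ` with `p ∤ c`** (`F` of characteristic `0`; `c ≡` the mod-`p^k` cyclotomic character, a unit since `τ` is bijective).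
[cite: SerreAbelianLadic1968, Ch. I §1.2] [folklore] -/
theorem exists_coprime_forall_mu_eq_nsmul (F : Type) [Field F] [CharZero F] (k : ℕ) (τ : absoluteGaloisGroup F) :
    ∃ c : ℕ, p.Coprime c ∧ ∀ ζ : MuCarrier F (p ^ k), mu F (p ^ k) τ ζ = c • ζ := by
  haveI : NeZero (p ^ k) := ⟨pow_ne_zero _ (Fact.out : p.Prime).ne_zero⟩
  let e := muEquivZMod F (p ^ k)
  set a : ZMod (p ^ k) := e (mu F (p ^ k) τ (e.symm 1)) with ha
  have hv : ∀ v : MuCarrier F (p ^ k), v = (e v).val • e.symm 1 := fun v ↦ by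
    apply e.injective
    rw [map_nsmul, e.apply_symm_apply, nsmul_eq_mul, mul_one, ZMod.natCast_zmod_val]
  have h0 : mu F (p ^ k) τ (e.symm 1) = (a.val + p ^ k) • e.symm 1 := by
    apply e.injective
    rw [map_nsmul, e.apply_symm_apply, nsmul_eq_mul, mul_one, Nat.cast_add, ZMod.natCast_zmod_val, ZMod.natCast_self, add_zero, ha]
  -- `τ` acts injectively on `μ_{p^k}`
  have hinj : Function.Injective (mu F (p ^ k) τ) := fun x y hxy ↦ by
    have h := congrArg (mu F (p ^ k) τ⁻¹) hxy
    rwa [← Module.End.mul_apply, ← map_mul, inv_mul_cancel, map_one, Module.End.one_apply, ← Module.End.mul_apply, ← map_mul, inv_mul_cancel,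
      map_one, Module.End.one_apply] at h
  refine ⟨a.val + p ^ k, ?_, fun ζ ↦ ?_⟩
  · -- `p ∤ a.val + p^k`: for `k = 0` the number is `1`; for `k ≥ 1`, `p ∣ a.val` would make `τ` kill the element `p^(k-1) • ζ₀` of order `p`
    refine ((Nat.Prime.coprime_iff_not_dvd Fact.out).mpr fun hdvd ↦ ?_)
    rcases Nat.eq_zero_or_pos k with hk | hk
    · subst hk
      have ha0 : a.val = 0 := by
        have := ZMod.val_lt a
        simp only [pow_zero] at this
        omega
      rw [ha0, pow_zero, zero_add] at hdvd
      exact (Fact.out : p.Prime).one_lt.ne' (Nat.dvd_one.mp hdvd)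
    · obtain ⟨t, ht⟩ := hdvd
      have hpk : p ^ (k - 1) * (a.val + p ^ k) = p ^ k * t := by
        rw [ht, ← mul_assoc, ← pow_succ, Nat.sub_add_cancel hk]
      have hkill : mu F (p ^ k) τ (p ^ (k - 1) • e.symm 1) = 0 := by
        have hz : p ^ k • e.symm (1 : ZMod (p ^ k)) = 0 := by
          apply e.injective
          rw [map_nsmul, e.apply_symm_apply, map_zero, nsmul_eq_mul, mul_one, ZMod.natCast_self]
        rw [map_nsmul, h0, smul_smul, hpk, mul_comm, ← smul_smul, hz, smul_zero]
      have hne : p ^ (k - 1) • e.symm (1 : ZMod (p ^ k)) ≠ 0 := by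
        intro h
        have h' := congrArg e h
        rw [map_nsmul, e.apply_symm_apply, map_zero, nsmul_eq_mul, mul_one, ZMod.natCast_eq_zero_iff] at h'
        exact Nat.not_dvd_of_pos_of_lt (pow_pos (Fact.out : p.Prime).pos _) (Nat.pow_lt_pow_right (Fact.out : p.Prime).one_lt (Nat.sub_lt hk Nat.one_pos)) h'
      exact hne (hinj (by rw [hkill, map_zero]))
  · conv_lhs => rw [hv ζ]
    rw [map_nsmul, h0, smul_smul, mul_comm, ← smul_smul, ← hv ζ]

/-- **If `τ ∈ Γ_{K_w}` acts on `μ_{p^k}(K̄_w)` as `ζ ↦ c•ζ`, then `res τ` acts on `μ_{p^k}(K̄)` as `v ↦ c•v`** (through the chosen embedding `ι : K̄ → K̄_w`: `ι((res τ) x) = τ(ι x)`).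
[cite: NeukirchANT1999, II §9 Prop. (9.6)] [folklore] -/
theorem mu_resGalOfEmb_eq_nsmul (k : ℕ) {τ : absoluteGaloisGroup (w.adicCompletion K)} {c : ℕ}
    (hτ : ∀ ζ : MuCarrier (w.adicCompletion K) (p ^ k), mu (w.adicCompletion K) (p ^ k) τ ζ = c • ζ) (v : MuCarrier K (p ^ k)) :
    mu K (p ^ k) (resGalOfEmb (closureEmb (K := K) (w.adicCompletion K)) τ) v = c • v := by
  haveI : NeZero (p ^ k) := ⟨pow_ne_zero _ (Fact.out : p.Prime).ne_zero⟩
  apply muVal_injective K (p ^ k)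
  rw [muVal_apply, muVal_nsmul]
  ext
  rw [Units.coe_smul, Units.val_pow_eq_pow_val]
  set ι := closureEmb (K := K) (w.adicCompletion K) with hι
  have hζ : (ι ((muVal K (p ^ k) v : (AlgebraicClosure K)ˣ) : AlgebraicClosure K)) ^ p ^ k = 1 := by
    rw [← map_pow, ← Units.val_pow_eq_pow_val, muVal_pow_eq_one, Units.val_one, map_one]
  have hfix := hτ (MuCarrier.ofRootsOfUnity (rootsOfUnity.mkOfPowEq _ hζ))
  have hfix' : τ • (ι ((muVal K (p ^ k) v : (AlgebraicClosure K)ˣ) : AlgebraicClosure K)) = (ι ((muVal K (p ^ k) v : (AlgebraicClosure K)ˣ) : AlgebraicClosure K)) ^ c := by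
    have h := congrArg (fun z ↦ ((muVal (w.adicCompletion K) (p ^ k) z : (AlgebraicClosure (w.adicCompletion K))ˣ) : AlgebraicClosure (w.adicCompletion K))) hfix
    simp only [muVal_apply, muVal_nsmul, muVal_ofRootsOfUnity, Units.coe_smul, Units.val_pow_eq_pow_val, rootsOfUnity.val_mkOfPowEq_coe] at h
    exact h
  have h' : ι ((resGalOfEmb ι τ) • ((muVal K (p ^ k) v : (AlgebraicClosure K)ˣ) : AlgebraicClosure K)) =
      ι (((muVal K (p ^ k) v : (AlgebraicClosure K)ˣ) : AlgebraicClosure K) ^ c) := by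
    rw [resGalOfEmb_apply, map_pow]
    exact (apply_resGalAuxOfEmb_apply ι τ _).trans hfix'
  exact ι.injective h'

/-- **Then `res τ` acts on `𝒪 ⊗ μ_{p^k}(K̄) ⊗ θ′` as the scalar `c · θ′(res τ)`** (`σ·(a ⊗ ζ) = θ′(σ)a ⊗ σζ = θ′(σ)a ⊗ c•ζ = (c θ′(σ) a) ⊗ ζ`). [cite: JohnsonLeungKings2011, Def. 1.1, §4.2] -/
theorem muTwistO_resGalOfEmb_eq_oMuScalar_mul (k : ℕ) {τ : absoluteGaloisGroup (w.adicCompletion K)} {c : ℕ}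
    (hτ : ∀ ζ : MuCarrier (w.adicCompletion K) (p ^ k), mu (w.adicCompletion K) (p ^ k) τ ζ = c • ζ) (x : OMuCarrier K S (p ^ k)) :
    muTwistO S θ' k (resGalOfEmb (closureEmb (K := K) (w.adicCompletion K)) τ) x =
      oMuScalar S (p ^ k) ((c : padicCoeffIntegers S) * ((θ' (resGalOfEmb (closureEmb (K := K) (w.adicCompletion K)) τ) : (padicCoeffIntegers S)ˣ) : padicCoeffIntegers S)) x := by
  induction x using OMuCarrier.induction_on with
  | zero => rw [map_zero, map_zero]
  | tmul a v =>
    rw [muTwistO_tmul, oMuScalar_tmul, mu_resGalOfEmb_eq_nsmul w k hτ, mul_assoc, ← nsmul_eq_mul]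
    change OMuCarrier.toTensor.symm (_ ⊗ₜ[ℤ] (c • v)) = OMuCarrier.toTensor.symm ((c • _) ⊗ₜ[ℤ] v)
    rw [TensorProduct.tmul_smul, TensorProduct.smul_tmul']
  | add x y hx hy => rw [map_add, map_add, hx, hy]

end Cyc

/-! ## §2 The levelwise uniform bound from `τ` over `K_∞` with `θ′(res τ) ≠ 1` (no `μ`-fixing) -/

section Bound

variable {K : Type} [Field K] [NumberField K] {p : ℕ} [Fact p.Prime] (S : Set (PadicAlgCl p)) [FiniteDimensional ℚ_[p] (padicCoeffField S)]
  (κ : ZpExtension K p) (θ' : absoluteGaloisGroup K →ₜ* (padicCoeffIntegers S)ˣ) (P : Set (HeightOneSpectrum (𝓞 K))) (w : HeightOneSpectrum (𝓞 K))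

/-- ★★★ **THE LEVELWISE UNIFORM BOUND WITHOUT THE `μ`-FIXING HYPOTHESIS**: for `τ, σ ∈ Γ_{K_w}` with `res τ ∈ U_n` for all `n`, `θ′(res τ) − 1 ∣ p^m` and `κ(res σ) = p^e·u₀`:
`#H²(Γ_{K_w}, Maps(Γ_K ⧸ U_n, X_k)) ≤ #(𝒪/p^m)^{p^e}` for ALL `n, k`. (As part 2's `finite_and_natCard_semilocCoh_two_le`, with `τ` acting on `μ_{p^k}` as the prime-to-`p` power `c`: the
`τ`-equivariant `g : X_k → μ_{p^k}` kill `c(θ′(res τ) − 1)X_k`, and `c` is invertible on `p`-groups.) [cite: NeukirchSchmidtWingberg2008, (7.2.6), (8.6.2)] [cite: MilneADT2006, I Cor. 2.3]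
[cite: PerrinRiou1994Invent, §1.3] -/
theorem finite_and_natCard_semilocCoh_two_le_of_apply
    {τ : absoluteGaloisGroup (w.adicCompletion K)} (hτU : ∀ n, resGalOfEmb (closureEmb (K := K) (w.adicCompletion K)) τ ∈ κ.layerSubgroup n)
    {m : ℕ} (hum : ((θ' (resGalOfEmb (closureEmb (K := K) (w.adicCompletion K)) τ) : (padicCoeffIntegers S)ˣ) : padicCoeffIntegers S) - 1 ∣
      ((p : ℕ) : padicCoeffIntegers S) ^ m)
    {σ : absoluteGaloisGroup (w.adicCompletion K)} {e : ℕ} {u₀ : ℤ_[p]ˣ}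
    (hσ : (κ (resGalOfEmb (closureEmb (K := K) (w.adicCompletion K)) σ)).toAdd = (p : ℤ_[p]) ^ e * u₀) (n k : ℕ) :
    Finite (semilocCoh S κ θ' P w n k 2) ∧
      Nat.card (semilocCoh S κ θ' P w n k 2) ≤
        Nat.card (padicCoeffIntegers S ⧸ (Ideal.span {((p : ℕ) : padicCoeffIntegers S) ^ m} : Ideal (padicCoeffIntegers S))) ^ p ^ e := by
  haveI : CharZero (w.adicCompletion K) := charZero_of_injective_algebraMap (algebraMap K (w.adicCompletion K)).injective
  haveI : NeZero (p ^ k) := ⟨pow_ne_zero _ (Fact.out : p.Prime).ne_zero⟩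
  haveI := SmallImageRttD2J2Delta.finite_coeffGSO P S θ' k
  haveI := SmallImageRttD2Seq.finite_oMuCarrier (K := K) S k
  haveI hfinΩ : Finite (MuCarrier (w.adicCompletion K) (p ^ k)) := finite_muCarrier (w.adicCompletion K) (p ^ k)
  haveI : Finite (absoluteGaloisGroup K ⧸ κ.layerSubgroup n → (coeffRepK S θ' P k).toTopRep) :=
    ContinuousRep.finite_coindOpen (κ.layerSubgroup n) (κ.isOpen_layerSubgroup n)
  haveI : Finite (absoluteGaloisGroup K ⧸ κ.layerSubgroup e) := Subgroup.quotient_finite_of_isOpen _ (κ.isOpen_layerSubgroup e)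
  letI : Fintype (absoluteGaloisGroup K ⧸ κ.layerSubgroup e) := Fintype.ofFinite _
  set res := resGalOfEmb (closureEmb (K := K) (w.adicCompletion K)) with hres
  set u : padicCoeffIntegers S := ((θ' (res τ) : (padicCoeffIntegers S)ˣ) : padicCoeffIntegers S) with hu
  -- the exponent `c` of `τ` on `μ_{p^k}`, prime to `p`
  obtain ⟨c, hcop, hc⟩ := exists_coprime_forall_mu_eq_nsmul (p := p) (w.adicCompletion K) k τ
  have hτX : ∀ x : OMuCarrier K S (p ^ k), muTwistO S θ' k (res τ) x = oMuScalar S (p ^ k) ((c : padicCoeffIntegers S) * u) x :=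
    fun x ↦ muTwistO_resGalOfEmb_eq_oMuScalar_mul S θ' w k hc x
  -- (0) local duality (2,0)
  obtain ⟨hfin, hcard⟩ := natCard_two_eq_natCard_invariants_homRep (w.adicCompletion K)
    (((coeffRepK S θ' P k).coindOpen (κ.layerSubgroup n) (κ.isOpen_layerSubgroup n)).restrict res) (fun φ ↦ by
      funext y
      rw [Pi.smul_apply, Pi.zero_apply, ← natCast_zsmul, Nat.cast_pow]
      exact coeffGSO_torsion S P θ' k _)
  refine ⟨hfin, ?_⟩
  change Nat.card (continuousCohomology 2 (((coeffRepK S θ' P k).coindOpen (κ.layerSubgroup n) (κ.isOpen_layerSubgroup n)).restrict res).toTopRep) ≤ _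
  rw [hcard]
  -- (1) orbit count
  have h1 := natCard_invariants_homRep_coindOpen_le (coeffRepK S θ' P k) (κ.layerSubgroup n) (κ.isOpen_layerSubgroup n) res
    (mu (w.adicCompletion K) (p ^ k)) (ι := absoluteGaloisGroup K ⧸ κ.layerSubgroup e)
    (fun d ↦ (QuotientGroup.mk d.out : absoluteGaloisGroup K ⧸ κ.layerSubgroup n)) (fun y ↦ by
      obtain ⟨t, d, h⟩ := exists_pow_smul_mk_out_eq κ hσ n y
      exact ⟨σ ^ t, d, by rw [map_pow]; exact h⟩) τ (smul_eq_self_of_mem_layerSubgroup κ (hτU n))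
  refine h1.trans ?_
  have hι : Fintype.card (absoluteGaloisGroup K ⧸ κ.layerSubgroup e) = p ^ e := by
    rw [← Nat.card_eq_fintype_card, ← Subgroup.index_eq_card, κ.index_layerSubgroup]
  rw [hι]
  refine Nat.pow_le_pow_left ?_ _
  -- (2) the `τ`-equivariant homomorphisms kill `c (u - 1) X_k`
  have hns : ∀ (d : ℕ) (y : OMuCarrier K S (p ^ k)), d • y = oMuScalar S (p ^ k) ((d : ℕ) : padicCoeffIntegers S) y := fun d y ↦ by
    induction y using OMuCarrier.induction_on with
    | zero => rw [smul_zero, map_zero]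
    | tmul a v =>
      rw [oMuScalar_tmul, ← nsmul_eq_mul]
      change d • OMuCarrier.toTensor.symm (a ⊗ₜ[ℤ] v) = OMuCarrier.toTensor.symm ((d • a) ⊗ₜ[ℤ] v)
      rw [← map_nsmul, TensorProduct.smul_tmul']
    | add x y hx hy => rw [smul_add, map_add, hx, hy]
  let φ : (coeffRepK S θ' P k).toTopRep →+ (coeffRepK S θ' P k).toTopRep :=
    (coeffMapO S P θ' (oMuScalar S (p ^ k) ((c : padicCoeffIntegers S) * (u - 1))) (oMuScalar_muTwistO S θ' k _)).toAddMonoidHom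
  have hφ : ∀ x : (coeffRepK S θ' P k).toTopRep, φ x = (coeffRepK S θ' P k) (res τ) x - c • x := fun x ↦ by
    apply Subtype.ext
    change oMuScalar S (p ^ k) ((c : padicCoeffIntegers S) * (u - 1)) (x : OMuCarrier K S (p ^ k)) =
      muTwistO S θ' k (res τ) (x : OMuCarrier K S (p ^ k)) - (((c • x : (coeffRepK S θ' P k).toTopRep)) : OMuCarrier K S (p ^ k))
    rw [hτX, AddSubmonoidClass.coe_nsmul, hns, mul_sub, mul_one]
    have h := oMuScalar_add S (p ^ k) ((c : padicCoeffIntegers S) * u - (c : padicCoeffIntegers S)) (c : padicCoeffIntegers S) (x : OMuCarrier K S (p ^ k))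
    rw [sub_add_cancel] at h
    exact eq_sub_of_add_eq h.symm
  haveI : Finite ((coeffRepK S θ' P k).toTopRep →+ MuCarrier (w.adicCompletion K) (p ^ k)) :=
    Finite.of_injective (fun g ↦ (g : (coeffRepK S θ' P k).toTopRep → MuCarrier (w.adicCompletion K) (p ^ k))) DFunLike.coe_injective
  have h2 : Nat.card {g : (coeffRepK S θ' P k).toTopRep →+ MuCarrier (w.adicCompletion K) (p ^ k) //
        ∀ x, g ((coeffRepK S θ' P k) (res τ) x) = mu (w.adicCompletion K) (p ^ k) τ (g x)} ≤
      Nat.card {g : (coeffRepK S θ' P k).toTopRep →+ MuCarrier (w.adicCompletion K) (p ^ k) // ∀ x, g (φ x) = 0} := by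
    refine Nat.card_le_card_of_injective (fun g ↦ ⟨g.1, fun x ↦ ?_⟩) (fun g g' h ↦ ?_)
    · rw [hφ, map_sub, g.2 x, hc, map_nsmul, sub_self]
    · have hh := congrArg Subtype.val h
      exact Subtype.ext hh
  refine h2.trans ?_
  -- (3) `#{g | g ∘ φ = 0} ≤ #ker φ ≤ #X_k[p^m] ≤ #(𝒪 ⊗ μ)[p^m] ≤ #(𝒪/p^m)`
  refine (natCard_subtype_comp_eq_zero_le_natCard_ker (muEquivZMod (w.adicCompletion K) (p ^ k)) φ).trans ?_
  obtain ⟨b, hb⟩ := hum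
  have h3 : φ.ker ≤ (nsmulAddMonoidHom (α := (coeffRepK S θ' P k).toTopRep) (p ^ m)).ker := by
    intro x hx
    rw [AddMonoidHom.mem_ker] at hx ⊢
    apply Subtype.ext
    have hx' : oMuScalar S (p ^ k) ((c : padicCoeffIntegers S) * (u - 1)) (x : OMuCarrier K S (p ^ k)) = 0 := congrArg Subtype.val hx
    change (((p ^ m) • x : (coeffRepK S θ' P k).toTopRep) : OMuCarrier K S (p ^ k)) = 0
    rw [AddSubmonoidClass.coe_nsmul]
    -- `c • (p^m • x) = (c (u-1) b) • x = 0`, and `c` is prime to `p`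
    refine SmallImageRttJunctionLocal.OMuCarrier.eq_zero_of_nsmul_eq_zero_of_coprime S k hcop.symm _ ?_
    rw [hns, hns, ← oMuScalar_mul, Nat.cast_pow, hb, ← mul_assoc, mul_comm ((c : padicCoeffIntegers S) * (u - 1)) b, oMuScalar_mul, hx', map_zero]
  refine (Nat.card_le_card_of_injective _ (AddSubgroup.inclusion_injective h3)).trans ?_
  refine le_trans ?_ (natCard_torsionBy_oMuCarrier_le (K := K) S k m)
  refine Nat.card_le_card_of_injective (fun x ↦ ⟨((x : (coeffRepK S θ' P k).toTopRep) : OMuCarrier K S (p ^ k)), ?_⟩) ?_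
  · have hx : (p ^ m) • (x : (coeffRepK S θ' P k).toTopRep) = 0 := x.2
    rw [AddMonoidHom.mem_ker]
    change (p ^ m) • ((x : (coeffRepK S θ' P k).toTopRep) : OMuCarrier K S (p ^ k)) = 0
    rw [← AddSubmonoidClass.coe_nsmul, hx]
    rfl
  · intro x y h
    have hh := congrArg Subtype.val h
    exact Subtype.ext (Subtype.ext hh)

/-- ★★★ **AT A NON-SPLIT PLACE, ONE `τ ∈ Γ_{K_v}` OVER `K_∞` WITH `θ′(res τ) ≠ 1` SUFFICES** (no `μ`-fixing): every level of the degree-2 semilocal Iwasawa module at `v` is finite with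
cardinality bounded independently of `n, k`. This is the form in which the displayed input of S3α′ at `vp` should be read: «`θ′` (equivalently the frame's `θ`, `θ′·θ₀₀ = 1`) is
non-trivial on `D_{vp} ∩ Gal(K̄/K_∞)`», i.e. (via the frame's `j`) «the local tower group at `vp` does not fix `E[p^∞]`» — Imai/Serre, in the tree modulo `μ_p ⊄ K_{vp}`.
[cite: Imai1975, Theorem (p. 12)] [cite: PerrinRiou1994Invent, §1.3] [cite: NeukirchSchmidtWingberg2008, (8.6.2)–(8.6.3)] -/
theorem exists_bound_semilocCoh_two_of_apply_ne_one' (hv : AcSigned.IsNonsplitIn κ w) {τ : absoluteGaloisGroup (w.adicCompletion K)}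
    (hτU : ∀ n, resGalOfEmb (closureEmb (K := K) (w.adicCompletion K)) τ ∈ κ.layerSubgroup n)
    (hτθ : θ' (resGalOfEmb (closureEmb (K := K) (w.adicCompletion K)) τ) ≠ 1) :
    (∀ n k, Finite (semilocCoh S κ θ' P w n k 2)) ∧ ∃ B : ℕ, ∀ n k, Nat.card (semilocCoh S κ θ' P w n k 2) ≤ B := by
  set u : padicCoeffIntegers S := ((θ' (resGalOfEmb (closureEmb (K := K) (w.adicCompletion K)) τ) : (padicCoeffIntegers S)ˣ) : padicCoeffIntegers S) with hu
  have hu1 : u - 1 ≠ 0 := fun h ↦ hτθ (Units.ext (by rw [← hu, Units.val_one]; exact sub_eq_zero.mp h))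
  obtain ⟨m, b, hmb⟩ := exists_pow_eq_mul_of_ne_zero S (u - 1) hu1
  obtain ⟨σ, hσ⟩ := hv (Multiplicative.ofAdd 1)
  have hσ' : κ (resGalOfEmb (closureEmb (K := K) (w.adicCompletion K)) σ) = Multiplicative.ofAdd 1 := hσ
  have hσ'' : (κ (resGalOfEmb (closureEmb (K := K) (w.adicCompletion K)) σ)).toAdd = (p : ℤ_[p]) ^ 0 * ((1 : ℤ_[p]ˣ) : ℤ_[p]) := by
    rw [hσ', toAdd_ofAdd, pow_zero, Units.val_one, mul_one]
  exact ⟨fun n k ↦ (finite_and_natCard_semilocCoh_two_le_of_apply S κ θ' P w hτU (Dvd.intro b hmb.symm) hσ'' n k).1,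
    ⟨_, fun n k ↦ (finite_and_natCard_semilocCoh_two_le_of_apply S κ θ' P w hτU (Dvd.intro b hmb.symm) hσ'' n k).2⟩⟩

end Bound

end Summit.BirchSwinnertonDyer.BirchSwinnertonDyer.Theorems.SmallImageRttJunctionSha

end
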